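import Summits.ValiantsHypothesis.ValiantsHypothesis.Theorems.KPlusLogSqLawLiftingRealDoubling

/-!
# Route «KPlusLogSqLaw» — GENERAL designs DOUBLE: `PosRootLawAt (m + m) K B → TropRootLawAt m K B`, so every general
# tropical row `T(m,K) ≥ n` is a symmetric real row `ζ₊sym(2m, K) ≥ n`

HONEST FRAMING.  Helper file (seat typer (g11), cell `pub-symmetroid`, 2026-08-27; `--supports` the `WeakLifting` item
stmt-ValiantsHypothesis-19561 as a helper, no closure claim).  Pure lemma file, no definitions; LOWER-bound census currency.  It composes two
tools already in the tree: the tree's Viro patchworking for GENERAL (not necessarily symmetric) designs (`MatrixDescartes.Negative.le_card_posRoots_patch`: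
a design with `n` alternations gives a general real `m × m` pencil with `≥ n` distinct positive determinant zeros) and conjb-3 g6 / typer g10's
same-`K` REAL DOUBLING (`RealDoubling.SD0`, `SD0_isSymm`, `card_roots_SD0`: the symmetric `(m+m) × (m+m)` pencil `[[0, P], [Pᵀ, 0]]` has exactly
the real root SET of `det P`).  CONSEQUENCE: **`tropRootLawAt_of_posRootLawAt_double : PosRootLawAt (m + m) K B → TropRootLawAt m K B`**, i.e.
`T(m,K) ≤ ζ₊sym(2m,K)` row by row; contrapositive `not_posRootLawAt_double_of_not_tropRootLawAt : ¬ TropRootLawAt m K B → ¬ PosRootLawAt (m + m) K B`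
— every GENERAL tropical census floor of the tree (val-sym-trop-p3 g5's `not_tropRootLawAt_three_family`: `T(3,K) ≥ 8K − 33` for `K ≥ 5`;
`not_tropRootLawAt_three_ten_53`; the `(5,4) ≥ 48` / `(6,4) ≥ 63` rows) becomes a symmetric REAL floor at double size with ONE application (e.g. `ζ₊sym(6,K) ≥ 8K − 33` for `K ≥ 5`; instances are left to the
row files that own the designs).  No grafting through the doubled pencil: its determinant is `± det(P)²` and does not
alternate, so the graft law's certificate form is not available here (use `…SymmetricDesignGraft` for SYMMETRIC designs).  Nothing here bears
on DoorA26 / DoorA34 (`PosRootLawAt 2 6 19` / `PosRootLawAt 3 4 18`, OPEN, typed, never asserted), on `TropicalB` / `WeakLifting`, on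
`MatrixDescartes` (stmt-ValiantsHypothesis-18050) or on `VP ≠ VNP`; a lower census bound refutes no law of record.  [folklore]
-/

-- `Summit.ValiantsHypothesis.ValiantsHypothesis.…` repeats a component by the D-0017 layout
-- (single-conjunct summit), which the `dupNamespace` linter flags; the name is mandated.
set_option linter.dupNamespace false
set_option autoImplicit false

namespace Summit.ValiantsHypothesis.ValiantsHypothesis.Theorems.KPlusLogSqLaw.RealDoubling

open Summit.ValiantsHypothesis.ValiantsHypothesis.Theorems.MatrixDescartes.Negative
open Summit.ValiantsHypothesis.ValiantsHypothesis.Theorems.LacunarySymmetroidMatrixDescartes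
open Summit.ValiantsHypothesis.ValiantsHypothesis.Theorems.LacunarySymmetroidMatrixDescartes.TropicalCensus
open scoped BigOperators
open Polynomial

variable {m K : ℕ}

/-- **General designs double**: the symmetric positive-root row at size `m + m` bounds the GENERAL tropical row at size `m`:
`PosRootLawAt (m + m) K B → TropRootLawAt m K B` (patchwork the design to a general pencil `P`, then count the positive roots of the
symmetric doubled pencil `[[0, P], [Pᵀ, 0]]`, which are those of `det P`). [folklore] -/
theorem tropRootLawAt_of_posRootLawAt_double {B : ℕ} (h : PosRootLawAt (m + m) K B) : TropRootLawAt m K B := by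
  intro d v ε n θ p hε hθ hdom halt
  obtain ⟨T, hT⟩ := le_card_posRoots_patch d v ε hε θ hθ p hdom halt
  have hrow := h d (SD0 T) (SD0_isSymm T)
  rw [card_roots_SD0] at hrow
  exact hT.trans hrow

/-- **Contrapositive form**: a general tropical floor is a symmetric real floor at double size —
`¬ TropRootLawAt m K B → ¬ PosRootLawAt (m + m) K B`. [folklore] -/
theorem not_posRootLawAt_double_of_not_tropRootLawAt {B : ℕ} (h : ¬ TropRootLawAt m K B) : ¬ PosRootLawAt (m + m) K B :=
  fun hrow => h (tropRootLawAt_of_posRootLawAt_double hrow)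

end Summit.ValiantsHypothesis.ValiantsHypothesis.Theorems.KPlusLogSqLaw.RealDoubling
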